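import Mathlib
import Summits.Ventures.PercRepro2.Defs
import Summits.Ventures.PercRepro2.Independence
import Summits.Ventures.PercRepro2.Harris
import Summits.Ventures.PercRepro2.Graph
import Summits.Ventures.PercRepro2.Exploration
import Summits.Ventures.PercRepro2.Events
import Summits.Ventures.PercRepro2.Statements
import Summits.Ventures.PercRepro2.FourFunctions
import Summits.Ventures.PercRepro2.Induced
import Summits.Ventures.PercRepro2.Frontier
import Summits.Ventures.PercRepro2.ObsIndependence
import Summits.Ventures.PercRepro2.BHK
import Summits.Ventures.PercRepro2.BHKEvents
import Summits.Ventures.PercRepro2.ClusterProperty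
import Summits.Ventures.PercRepro2.BHKPair
import Summits.Ventures.PercRepro2.CondAvoidPA
import Summits.Ventures.PercRepro2.CondAvoidZPA
import Summits.Ventures.PercRepro2.BoxUnionDefs
import Summits.Ventures.PercRepro2.BoxUnion
import Summits.Ventures.PercRepro2.BoxUnionPair
import Summits.Ventures.PercRepro2.PairTP2
import Summits.Ventures.PercRepro2.PairTP2Main
import Summits.Ventures.PercRepro2.UnionRowMech
import Summits.Ventures.PercRepro2.UnionRowMech2
import Summits.Ventures.PercRepro2.UnionRowGrid

/-!
# The double-exclusion two-status union row on every graph, outside the residual cases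
(blind cell PercRepro2, mine-1 g39; proofs/MINE1-UNIONROW2.md §4, §7)

The four remaining avoidance sets of `UnionRowMech2` — `{u ≠ T}` (`t ↮ {s, u}`), `{v ≠ S}`
(`s ↮ {t, v}`), `{u, v ≠ T}` (`t ↮ {s, u, v}`), `{u, v ≠ S}` (`s ↮ {t, u, v}`) — carry the same
positive-association facts as `R`, `R′` in `UnionRowGrid` (`pa_Ru`, `pa_Rv'`, `pa_R₀`, `pa_R₀'`,
all from `CondAvoid.zpa_given_avoid`). Hence, by `UnionRowMech.double_exclusion_nonneg`:

**THEOREM** (`double_exclusion_row`): for every finite graph, admissible weight vector and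
up-sets `A, B` of the status grid outside the residual pair of membership patterns,
`Z·(Z·M(A∩B) − M(A)M(B)) − M(S,T)·Δ_A(S,T)Δ_B(S,T) − M(T,S)·Δ_A(T,S)Δ_B(T,S) ≥ 0` —
the two-status union row of row 2′CON-U for `X = Y = {u, v}`.
-/

namespace Summit.Ventures.PercRepro2

namespace UnionRowGrid

open Finset UnionRowMech
open scoped Classical

variable {V : Type*} {E : Type*} [Fintype V] [DecidableEq V] [Fintype E] [DecidableEq E]
variable (ends : E → Sym2 V) (s t u v : V) {p : E → ℝ}

/-! ### The four avoidance identities -/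

omit [DecidableEq E] in
/-- On `grid ∈ A` with `A ⊆ Ru` (`u ≠ T`), `{s ↮ t}` is the avoidance of `{s, u}` by the cluster
of `t`. -/
lemma indicator_Q_eq_avoid_of_mem_Ru {A : Finset Grid} (hAR : A ⊆ Ru) (ω : Config E) :
    gridInd u v A (cluster ends ω s) (cluster ends ω t) *
        ((connEvent ends s t)ᶜ).indicator (1 : Config E → ℝ) ω =
      gridInd u v A (cluster ends ω s) (cluster ends ω t) *
        (CondAvoid.avoidEvent ends t {s, u}).indicator 1 ω := by
  rw [gridInd_cluster]
  by_cases hA : PairTP2.grid ends s t u v ω ∈ A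
  · rw [if_pos hA, one_mul, one_mul]
    have hu : PairTP2.code ends s t ω u ≠ 0 := by
      have := hAR hA
      simp only [Ru, Finset.mem_filter, Finset.mem_univ, true_and] at this
      exact this
    rw [Ne, PairTP2.code_eq_zero_iff] at hu
    by_cases hQ : ω ∈ (connEvent ends s t)ᶜ
    · have hav : ω ∈ CondAvoid.avoidEvent ends t {s, u} := by
        intro x hx
        simp only [Finset.mem_insert, Finset.mem_singleton] at hx
        rcases hx with rfl | rfl
        · exact fun h => hQ (conn_symm h)
        · intro htu
          have hsu : Conn ends ω s x := by
            by_contra hsu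
            exact hu ⟨hsu, htu⟩
          exact hQ (conn_trans hsu (conn_symm htu))
      rw [Set.indicator_of_mem hQ, Set.indicator_of_mem hav]
    · have hav : ω ∉ CondAvoid.avoidEvent ends t {s, u} := by
        intro h
        exact hQ (fun h' => h s (by simp) (conn_symm h'))
      rw [Set.indicator_of_notMem hQ, Set.indicator_of_notMem hav]
  · rw [if_neg hA, zero_mul, zero_mul]

omit [DecidableEq E] in
/-- On `grid ∈ A` with `A ⊆ Rv′` (`v ≠ S`), `{s ↮ t}` is the avoidance of `{t, v}` by the cluster
of `s`. -/
lemma indicator_Q_eq_avoid_of_mem_Rv' {A : Finset Grid} (hAR : A ⊆ Rv') (ω : Config E) :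
    gridInd u v A (cluster ends ω s) (cluster ends ω t) *
        ((connEvent ends s t)ᶜ).indicator (1 : Config E → ℝ) ω =
      gridInd u v A (cluster ends ω s) (cluster ends ω t) *
        (CondAvoid.avoidEvent ends s {t, v}).indicator 1 ω := by
  rw [gridInd_cluster]
  by_cases hA : PairTP2.grid ends s t u v ω ∈ A
  · rw [if_pos hA, one_mul, one_mul]
    have hv : PairTP2.code ends s t ω v ≠ 2 := by
      have := hAR hA
      simp only [Rv', Finset.mem_filter, Finset.mem_univ, true_and] at this
      exact this
    rw [Ne, PairTP2.code_eq_two_iff] at hv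
    by_cases hQ : ω ∈ (connEvent ends s t)ᶜ
    · have hav : ω ∈ CondAvoid.avoidEvent ends s {t, v} := by
        intro x hx
        simp only [Finset.mem_insert, Finset.mem_singleton] at hx
        rcases hx with rfl | rfl
        · exact hQ
        · exact hv
      rw [Set.indicator_of_mem hQ, Set.indicator_of_mem hav]
    · have hav : ω ∉ CondAvoid.avoidEvent ends s {t, v} := by
        intro h
        exact hQ (h t (by simp))
      rw [Set.indicator_of_notMem hQ, Set.indicator_of_notMem hav]
  · rw [if_neg hA, zero_mul, zero_mul]

omit [DecidableEq E] in
/-- On `grid ∈ A` with `A ⊆ R₀` (`u, v ≠ T`), `{s ↮ t}` is the avoidance of `{s, u, v}` by the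
cluster of `t`. -/
lemma indicator_Q_eq_avoid_of_mem_R₀ {A : Finset Grid} (hAR : A ⊆ R₀) (ω : Config E) :
    gridInd u v A (cluster ends ω s) (cluster ends ω t) *
        ((connEvent ends s t)ᶜ).indicator (1 : Config E → ℝ) ω =
      gridInd u v A (cluster ends ω s) (cluster ends ω t) *
        (CondAvoid.avoidEvent ends t {s, u, v}).indicator 1 ω := by
  rw [gridInd_cluster]
  by_cases hA : PairTP2.grid ends s t u v ω ∈ A
  · rw [if_pos hA, one_mul, one_mul]
    have huv : PairTP2.code ends s t ω u ≠ 0 ∧ PairTP2.code ends s t ω v ≠ 0 := by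
      have := hAR hA
      simp only [R₀, Finset.mem_filter, Finset.mem_univ, true_and] at this
      exact this
    rw [Ne, PairTP2.code_eq_zero_iff, Ne, PairTP2.code_eq_zero_iff] at huv
    by_cases hQ : ω ∈ (connEvent ends s t)ᶜ
    · have hav : ω ∈ CondAvoid.avoidEvent ends t {s, u, v} := by
        intro x hx
        simp only [Finset.mem_insert, Finset.mem_singleton] at hx
        rcases hx with rfl | rfl | rfl
        · exact fun h => hQ (conn_symm h)
        · intro htu
          have hsu : Conn ends ω s x := by
            by_contra hsu
            exact huv.1 ⟨hsu, htu⟩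
          exact hQ (conn_trans hsu (conn_symm htu))
        · intro htv
          have hsv : Conn ends ω s x := by
            by_contra hsv
            exact huv.2 ⟨hsv, htv⟩
          exact hQ (conn_trans hsv (conn_symm htv))
      rw [Set.indicator_of_mem hQ, Set.indicator_of_mem hav]
    · have hav : ω ∉ CondAvoid.avoidEvent ends t {s, u, v} := by
        intro h
        exact hQ (fun h' => h s (by simp) (conn_symm h'))
      rw [Set.indicator_of_notMem hQ, Set.indicator_of_notMem hav]
  · rw [if_neg hA, zero_mul, zero_mul]

omit [DecidableEq E] in
/-- On `grid ∈ A` with `A ⊆ R₀′` (`u, v ≠ S`), `{s ↮ t}` is the avoidance of `{t, u, v}` by the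
cluster of `s`. -/
lemma indicator_Q_eq_avoid_of_mem_R₀' {A : Finset Grid} (hAR : A ⊆ R₀') (ω : Config E) :
    gridInd u v A (cluster ends ω s) (cluster ends ω t) *
        ((connEvent ends s t)ᶜ).indicator (1 : Config E → ℝ) ω =
      gridInd u v A (cluster ends ω s) (cluster ends ω t) *
        (CondAvoid.avoidEvent ends s {t, u, v}).indicator 1 ω := by
  rw [gridInd_cluster]
  by_cases hA : PairTP2.grid ends s t u v ω ∈ A
  · rw [if_pos hA, one_mul, one_mul]
    have huv : PairTP2.code ends s t ω u ≠ 2 ∧ PairTP2.code ends s t ω v ≠ 2 := by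
      have := hAR hA
      simp only [R₀', Finset.mem_filter, Finset.mem_univ, true_and] at this
      exact this
    rw [Ne, PairTP2.code_eq_two_iff, Ne, PairTP2.code_eq_two_iff] at huv
    by_cases hQ : ω ∈ (connEvent ends s t)ᶜ
    · have hav : ω ∈ CondAvoid.avoidEvent ends s {t, u, v} := by
        intro x hx
        simp only [Finset.mem_insert, Finset.mem_singleton] at hx
        rcases hx with rfl | rfl | rfl
        · exact hQ
        · exact huv.1
        · exact huv.2
      rw [Set.indicator_of_mem hQ, Set.indicator_of_mem hav]
    · have hav : ω ∉ CondAvoid.avoidEvent ends s {t, u, v} := by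
        intro h
        exact hQ (h t (by simp))
      rw [Set.indicator_of_notMem hQ, Set.indicator_of_notMem hav]
  · rw [if_neg hA, zero_mul, zero_mul]

/-! ### The masses of the four avoidance sets -/

/-- `M(Ru) = P(t ↮ {s, u})`. -/
lemma mass_Ru_eq :
    mass (gridMass ends s t u v p) Ru = prob p (CondAvoid.avoidEvent ends t {s, u}) := by
  rw [mass_gridMass_eq, prob_eq_expect_indicator]
  refine congrArg (expect p) (funext fun ω => ?_)
  rw [indicator_Q_eq_avoid_of_mem_Ru ends s t u v (subset_refl Ru), gridInd_cluster]
  by_cases hav : ω ∈ CondAvoid.avoidEvent ends t {s, u}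
  · rw [Set.indicator_of_mem hav, Pi.one_apply, mul_one]
    have hR : PairTP2.grid ends s t u v ω ∈ Ru := by
      simp only [Ru, Finset.mem_filter, Finset.mem_univ, true_and, PairTP2.grid]
      rw [Ne, PairTP2.code_eq_zero_iff]
      exact fun h => hav u (by simp) h.2
    rw [if_pos hR]
  · rw [Set.indicator_of_notMem hav, mul_zero]

/-- `M(Rv′) = P(s ↮ {t, v})`. -/
lemma mass_Rv'_eq :
    mass (gridMass ends s t u v p) Rv' = prob p (CondAvoid.avoidEvent ends s {t, v}) := by
  rw [mass_gridMass_eq, prob_eq_expect_indicator]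
  refine congrArg (expect p) (funext fun ω => ?_)
  rw [indicator_Q_eq_avoid_of_mem_Rv' ends s t u v (subset_refl Rv'), gridInd_cluster]
  by_cases hav : ω ∈ CondAvoid.avoidEvent ends s {t, v}
  · rw [Set.indicator_of_mem hav, Pi.one_apply, mul_one]
    have hR : PairTP2.grid ends s t u v ω ∈ Rv' := by
      simp only [Rv', Finset.mem_filter, Finset.mem_univ, true_and, PairTP2.grid]
      rw [Ne, PairTP2.code_eq_two_iff]
      exact hav v (by simp)
    rw [if_pos hR]
  · rw [Set.indicator_of_notMem hav, mul_zero]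

/-- `M(R₀) = P(t ↮ {s, u, v})`. -/
lemma mass_R₀_eq :
    mass (gridMass ends s t u v p) R₀ = prob p (CondAvoid.avoidEvent ends t {s, u, v}) := by
  rw [mass_gridMass_eq, prob_eq_expect_indicator]
  refine congrArg (expect p) (funext fun ω => ?_)
  rw [indicator_Q_eq_avoid_of_mem_R₀ ends s t u v (subset_refl R₀), gridInd_cluster]
  by_cases hav : ω ∈ CondAvoid.avoidEvent ends t {s, u, v}
  · rw [Set.indicator_of_mem hav, Pi.one_apply, mul_one]
    have hR : PairTP2.grid ends s t u v ω ∈ R₀ := by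
      simp only [R₀, Finset.mem_filter, Finset.mem_univ, true_and, PairTP2.grid]
      rw [Ne, PairTP2.code_eq_zero_iff, Ne, PairTP2.code_eq_zero_iff]
      exact ⟨fun h => hav u (by simp) h.2, fun h => hav v (by simp) h.2⟩
    rw [if_pos hR]
  · rw [Set.indicator_of_notMem hav, mul_zero]

/-- `M(R₀′) = P(s ↮ {t, u, v})`. -/
lemma mass_R₀'_eq :
    mass (gridMass ends s t u v p) R₀' = prob p (CondAvoid.avoidEvent ends s {t, u, v}) := by
  rw [mass_gridMass_eq, prob_eq_expect_indicator]
  refine congrArg (expect p) (funext fun ω => ?_)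
  rw [indicator_Q_eq_avoid_of_mem_R₀' ends s t u v (subset_refl R₀'), gridInd_cluster]
  by_cases hav : ω ∈ CondAvoid.avoidEvent ends s {t, u, v}
  · rw [Set.indicator_of_mem hav, Pi.one_apply, mul_one]
    have hR : PairTP2.grid ends s t u v ω ∈ R₀' := by
      simp only [R₀', Finset.mem_filter, Finset.mem_univ, true_and, PairTP2.grid]
      rw [Ne, PairTP2.code_eq_two_iff, Ne, PairTP2.code_eq_two_iff]
      exact ⟨hav u (by simp), hav v (by simp)⟩
    rw [if_pos hR]
  · rw [Set.indicator_of_notMem hav, mul_zero]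

/-! ### The four positive-association facts -/

/-- PA of up-sets inside `{u ≠ T}` under the grid masses restricted there. -/
theorem pa_Ru (hp : IsProbVec p) (A B : Finset Grid) (hA : IsUp A) (hB : IsUp B) (hAR : A ⊆ Ru)
    (hBR : B ⊆ Ru) :
    mass (gridMass ends s t u v p) A * mass (gridMass ends s t u v p) B ≤
      mass (gridMass ends s t u v p) (A ∩ B) * mass (gridMass ends s t u v p) Ru := by
  have key := CondAvoid.zpa_given_avoid p hp ends s t (X := {s, u}) (by simp)
    (isZMono_gridInd u v hA) (isZMono_gridInd u v hB) (gridInd_nonneg u v A)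
    (gridInd_nonneg u v B) (gridInd_le_one u v A) (gridInd_le_one u v B)
  simp only [gridInd_mul] at key
  rw [mass_gridMass_eq, mass_gridMass_eq, mass_gridMass_eq, mass_Ru_eq]
  have hABR : A ∩ B ⊆ Ru := fun k hk => hAR (Finset.mem_inter.1 hk).1
  simp_rw [indicator_Q_eq_avoid_of_mem_Ru ends s t u v hAR,
    indicator_Q_eq_avoid_of_mem_Ru ends s t u v hBR,
    indicator_Q_eq_avoid_of_mem_Ru ends s t u v hABR]
  exact key

/-- PA of down-sets inside `{v ≠ S}` under the grid masses restricted there. -/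
theorem pa_Rv' (hp : IsProbVec p) (A B : Finset Grid) (hA : IsDown A) (hB : IsDown B)
    (hAR : A ⊆ Rv') (hBR : B ⊆ Rv') :
    mass (gridMass ends s t u v p) A * mass (gridMass ends s t u v p) B ≤
      mass (gridMass ends s t u v p) (A ∩ B) * mass (gridMass ends s t u v p) Rv' := by
  have key := CondAvoid.zpa_given_avoid p hp ends t s (X := {t, v}) (by simp)
    (isZMono_gridInd_swap u v hA) (isZMono_gridInd_swap u v hB)
    (fun W C => gridInd_nonneg u v A C W) (fun W C => gridInd_nonneg u v B C W)
    (fun W C => gridInd_le_one u v A C W) (fun W C => gridInd_le_one u v B C W)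
  simp only [gridInd_mul] at key
  rw [mass_gridMass_eq, mass_gridMass_eq, mass_gridMass_eq, mass_Rv'_eq]
  have hABR : A ∩ B ⊆ Rv' := fun k hk => hAR (Finset.mem_inter.1 hk).1
  simp_rw [indicator_Q_eq_avoid_of_mem_Rv' ends s t u v hAR,
    indicator_Q_eq_avoid_of_mem_Rv' ends s t u v hBR,
    indicator_Q_eq_avoid_of_mem_Rv' ends s t u v hABR]
  exact key

/-- PA of up-sets inside `{u, v ≠ T}` under the grid masses restricted there. -/
theorem pa_R₀ (hp : IsProbVec p) (A B : Finset Grid) (hA : IsUp A) (hB : IsUp B) (hAR : A ⊆ R₀)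
    (hBR : B ⊆ R₀) :
    mass (gridMass ends s t u v p) A * mass (gridMass ends s t u v p) B ≤
      mass (gridMass ends s t u v p) (A ∩ B) * mass (gridMass ends s t u v p) R₀ := by
  have key := CondAvoid.zpa_given_avoid p hp ends s t (X := {s, u, v}) (by simp)
    (isZMono_gridInd u v hA) (isZMono_gridInd u v hB) (gridInd_nonneg u v A)
    (gridInd_nonneg u v B) (gridInd_le_one u v A) (gridInd_le_one u v B)
  simp only [gridInd_mul] at key
  rw [mass_gridMass_eq, mass_gridMass_eq, mass_gridMass_eq, mass_R₀_eq]
  have hABR : A ∩ B ⊆ R₀ := fun k hk => hAR (Finset.mem_inter.1 hk).1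
  simp_rw [indicator_Q_eq_avoid_of_mem_R₀ ends s t u v hAR,
    indicator_Q_eq_avoid_of_mem_R₀ ends s t u v hBR,
    indicator_Q_eq_avoid_of_mem_R₀ ends s t u v hABR]
  exact key

/-- PA of down-sets inside `{u, v ≠ S}` under the grid masses restricted there. -/
theorem pa_R₀' (hp : IsProbVec p) (A B : Finset Grid) (hA : IsDown A) (hB : IsDown B)
    (hAR : A ⊆ R₀') (hBR : B ⊆ R₀') :
    mass (gridMass ends s t u v p) A * mass (gridMass ends s t u v p) B ≤
      mass (gridMass ends s t u v p) (A ∩ B) * mass (gridMass ends s t u v p) R₀' := by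
  have key := CondAvoid.zpa_given_avoid p hp ends t s (X := {t, u, v}) (by simp)
    (isZMono_gridInd_swap u v hA) (isZMono_gridInd_swap u v hB)
    (fun W C => gridInd_nonneg u v A C W) (fun W C => gridInd_nonneg u v B C W)
    (fun W C => gridInd_le_one u v A C W) (fun W C => gridInd_le_one u v B C W)
  simp only [gridInd_mul] at key
  rw [mass_gridMass_eq, mass_gridMass_eq, mass_gridMass_eq, mass_R₀'_eq]
  have hABR : A ∩ B ⊆ R₀' := fun k hk => hAR (Finset.mem_inter.1 hk).1
  simp_rw [indicator_Q_eq_avoid_of_mem_R₀' ends s t u v hAR,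
    indicator_Q_eq_avoid_of_mem_R₀' ends s t u v hBR,
    indicator_Q_eq_avoid_of_mem_R₀' ends s t u v hABR]
  exact key

/-! ### The theorem -/

/-- **The double-exclusion two-status union row holds on every graph** outside the residual
membership patterns (grid form): for every admissible weight vector and up-sets `A, B` of the
status grid with `¬ ((S,T) ∈ A ∩ B ∧ (T,S) ∉ A ∪ B)` and the mirror,
`Z·(Z·M(A∩B) − M(A)M(B)) − M(S,T)·Δ_A(S,T)Δ_B(S,T) − M(T,S)·Δ_A(T,S)Δ_B(T,S) ≥ 0`. -/
theorem double_exclusion_row (hp : IsProbVec p) {A B : Finset Grid} (hA : IsUp A) (hB : IsUp B)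
    (hres : ¬ ((UnionRowMech.ST ∈ A ∧ UnionRowMech.ST ∈ B ∧ TS ∉ A ∧ TS ∉ B) ∨
      (TS ∈ A ∧ TS ∈ B ∧ UnionRowMech.ST ∉ A ∧ UnionRowMech.ST ∉ B))) :
    0 ≤ total (gridMass ends s t u v p) *
        (total (gridMass ends s t u v p) * mass (gridMass ends s t u v p) (A ∩ B) -
          mass (gridMass ends s t u v p) A * mass (gridMass ends s t u v p) B) -
      gridMass ends s t u v p UnionRowMech.ST *
        (total (gridMass ends s t u v p) * (if UnionRowMech.ST ∈ A then 1 else 0) -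
          mass (gridMass ends s t u v p) A) *
        (total (gridMass ends s t u v p) * (if UnionRowMech.ST ∈ B then 1 else 0) -
          mass (gridMass ends s t u v p) B) -
      gridMass ends s t u v p TS *
        (total (gridMass ends s t u v p) * (if TS ∈ A then 1 else 0) -
          mass (gridMass ends s t u v p) A) *
        (total (gridMass ends s t u v p) * (if TS ∈ B then 1 else 0) -
          mass (gridMass ends s t u v p) B) :=
  double_exclusion_nonneg (gridMass_nonneg ends s t u v hp)
    (fun A B hA hB => pa_Q ends s t u v hp A B hA hB)
    (fun A B hA hB hAR hBR => pa_R ends s t u v hp A B hA hB hAR hBR)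
    (fun A B hA hB hAR hBR => pa_R' ends s t u v hp A B hA hB hAR hBR)
    (fun A B hA hB hAR hBR => pa_Ru ends s t u v hp A B hA hB hAR hBR)
    (fun A B hA hB hAR hBR => pa_Rv' ends s t u v hp A B hA hB hAR hBR)
    (fun A B hA hB hAR hBR => pa_R₀ ends s t u v hp A B hA hB hAR hBR)
    (fun A B hA hB hAR hBR => pa_R₀' ends s t u v hp A B hA hB hAR hBR) hA hB hres

end UnionRowGrid

end Summit.Ventures.PercRepro2
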